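import Summits.PneNP.PneNP.Theorems.SymmetryBudgetNoHiddenOrderDecodeAnalysis

/-!
# `NoHiddenOrder` (stmt-PneNP-14781), (R2c) value layer IV: the decode module performs the walk

Route `PneNP/SymmetryBudget`; definitions in `SymmetryBudgetNoHiddenOrderDecodeDefs.lean`, analysis semantics in
`…DecodeAnalysis.lean`.  Main result `Decode.stateReads_walk`: if the stage-`0` state wires of a decode module read a walk
state `S₀` satisfying the walk invariant (`CGBits.WInv`) with colours `< D` everywhere, the adjacency wires read `G`, and
`|V|² ≤ N`, `|V| ≤ T`, `|V| ≤ D`, then for every `k ≤ F` the stage-`k` state wires read `CGBits.walk G L S₀ k` — the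
module performs the replay walk of its label `L = ⟨U, X, λ⟩` (`stateReads_succ`: one transition is one `wstep`, by the
case analysis of `wstep` — frozen / section step / individualisation step / leaf — against the step selectors
`takeAnd`, `takeOr` and the multiplexers).  With `CGBits.replay_eq_result_root` this makes the final stage read the
scheme's decoding `CertifiedLabels.replay (cgProcess G) L I₀ ∅`.  Sorry-free; supports stmt-PneNP-14781.
-/

set_option linter.dupNamespace false -- `Summit.PneNP.PneNP.…` (D-0017 single-conjunct layout)

namespace Summit.PneNP.PneNP.Theorems

open Finset Literature.Computability.Complexity Literature.Computability.Complexity.SymProg CGBits CGBits.WState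

namespace Decode

variable {ι Λ : Type*} [DecidableEq ι] [DecidableEq Λ] {P : SymProg ι Λ}
variable {V : Type*} [Fintype V] [DecidableEq V] {N T D F : ℕ} {U X : Finset V} {lam : V → ℕ}
variable {Dc : Decode P V N T D U X lam F} {x : ι → Bool}
variable {G : SimpleGraph V} [DecidableRel G.Adj] {n : ℕ}

/-- The label decoded. [folklore] -/
abbrev lab (_Dc : Decode P V N T D U X lam F) : CertifiedLabels.Label V := ⟨U, X, lam⟩

/-- The global hypotheses: adjacency reads `G`, the three bounds. -/
structure Hyp (Dc : Decode P V N T D U X lam F) (x : ι → Bool) (G : SimpleGraph V) : Prop where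
  /-- adjacency -/
  adj_iff : ∀ a b, wval x (P.sem x) (Dc.adj a b) = true ↔ G.Adj a b
  /-- count bound -/
  hN : Fintype.card V ^ 2 ≤ N
  /-- round bound -/
  hT : Fintype.card V ≤ T
  /-- value range -/
  hD : Fintype.card V ≤ D

section Stage

variable (h : Dc.Hyp x G) {k : Fin F} {S : WState V} (hread : Dc.StateReads x k.castSucc S) (hcol : ∀ v, S.col v < D)
include h hread hcol

omit [DecidableRel G.Adj] in
/-- The analysis of stage `k` satisfies its hypotheses. [folklore] -/
theorem hypAn : (Dc.An k.castSucc).Hyp x G S where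
  reads :=
    { mem_iff := fun u => by rw [Dc.An_mem]; exact hread.mem_iff u
      val_iff := fun u c => by rw [Dc.An_val]; exact hread.val_iff u c
      cons_iff := fun u => by rw [Dc.An_cons]; exact hread.cons_iff u
      dead_iff := by rw [Dc.An_dead]; exact hread.dead_iff }
  adj_iff a b := by rw [Dc.An_adj]; exact h.adj_iff a b
  col_lt := hcol
  hN := h.hN
  hT := h.hT

/-! ### The individualised colouring and its refinement -/

/-- **`ltI`** reads the order of `indiv col y` at the dominating `y`. [folklore] -/
theorem sem_ltI_iff (hinv : 2 ≤ S.A.card → EqIn G S.A S.col ∧ ConnIn G S.A S.col) (hA : 2 ≤ S.A.card) {y : V}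
    (hy : Dom (lab Dc) S y) (u v : V) :
    P.sem x (Dc.ltI k u v) = true ↔ BranchSum.indiv S.col y u < BranchSum.indiv S.col y v := by
  have hH := hypAn h hread hcol
  rw [BranchSum.indiv_lt_iff, P.sem_or (Dc.kind_ltI k u v), Dc.srcs_ltI]
  simp only [mem_insert, mem_singleton, exists_eq_or_imp, exists_eq_left, wval_inr, DAnalysis.sem_lt_iff hH]
  rw [P.sem_and (Dc.kind_tieD k u v), Dc.srcs_tieD]
  simp only [mem_insert, mem_singleton, forall_eq_or_imp, forall_eq, wval_inr, DAnalysis.sem_eq_iff hH,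
    DAnalysis.sem_dom_iff_eq hH hinv hA hy, P.sem_nor_singleton ((Dc.An k.castSucc).kind_ndom u)
      ((Dc.An k.castSucc).srcs_ndom u), Bool.not_eq_true', ← Bool.not_eq_true]

/-- **`eqI`** reads the kernel of `indiv col y`. [folklore] -/
theorem sem_eqI_iff (hinv : 2 ≤ S.A.card → EqIn G S.A S.col ∧ ConnIn G S.A S.col) (hA : 2 ≤ S.A.card) {y : V}
    (hy : Dom (lab Dc) S y) (u v : V) :
    P.sem x (Dc.eqI k u v) = true ↔ BranchSum.indiv S.col y u = BranchSum.indiv S.col y v := by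
  have hH := hypAn h hread hcol
  rw [BranchSum.indiv_eq_iff, P.sem_and (Dc.kind_eqI k u v), Dc.srcs_eqI]
  simp only [mem_insert, mem_singleton, forall_eq_or_imp, forall_eq, wval_inr, DAnalysis.sem_eq_iff hH]
  rw [P.sem_or (Dc.kind_deqv k u v), Dc.srcs_deqv]
  simp only [mem_insert, mem_singleton, exists_eq_or_imp, exists_eq_left, wval_inr]
  rw [P.sem_and (Dc.kind_bothD k u v), Dc.srcs_bothD, P.sem_nor (Dc.kind_noneD k u v), Dc.srcs_noneD]
  simp only [mem_insert, mem_singleton, forall_eq_or_imp, forall_eq, wval_inr, DAnalysis.sem_dom_iff_eq hH hinv hA hy,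
    Bool.eq_false_iff, ne_eq]
  tauto

/-- The refinement module of stage `k` reads the block and the individualised colouring. [folklore] -/
theorem reads_RV (hinv : 2 ≤ S.A.card → EqIn G S.A S.col ∧ ConnIn G S.A S.col) (hA : 2 ≤ S.A.card) {y : V}
    (hy : Dom (lab Dc) S y) : (Dc.RV k).Reads x G S.A (BranchSum.indiv S.col y) where
  mem_iff u := by rw [Dc.RV_mem]; exact hread.mem_iff u
  adj_iff a b := by rw [Dc.RV_adj]; exact h.adj_iff a b
  lt0_iff a _ b _ := by rw [Dc.RV_lt0, wval_inr]; exact sem_ltI_iff h hread hcol hinv hA hy a b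
  eq0_iff a _ b _ := by rw [Dc.RV_eq0, wval_inr]; exact sem_eqI_iff h hread hcol hinv hA hy a b

/-- **The new value wires read the refined individualised colouring.** [folklore] -/
theorem sem_RVval_iff (hinv : 2 ≤ S.A.card → EqIn G S.A S.col ∧ ConnIn G S.A S.col) (hA : 2 ≤ S.A.card) {y : V}
    (hy : Dom (lab Dc) S y) (v : V) (c : Fin D) :
    P.sem x ((Dc.RV k).val v c) = true ↔ BranchSum.refineIn G S.A (BranchSum.indiv S.col y) v = c :=
  RefVal.sem_val_iff (reads_RV h hread hcol hinv hA hy) (DAnalysis.card_le_N (hypAn h hread hcol) _)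
    ((card_le_univ _).trans (h.hT.trans (Nat.le_succ T))) v c

/-! ### The step selectors -/

/-- **`takeAnd`**: a section step is taken. [folklore] -/
theorem sem_takeAnd_iff : P.sem x (Dc.takeAnd k) = true ↔
    ¬ (S.dead = true ∨ Stop (lab Dc) S) ∧ IsAND G S ∧ AndOK G (lab Dc) S := by
  have hH := hypAn h hread hcol
  rw [P.sem_and (Dc.kind_takeAnd k), Dc.srcs_takeAnd]
  simp only [mem_insert, mem_singleton, forall_eq_or_imp, forall_eq, wval_inr, DAnalysis.sem_nfrozen_iff hH,
    DAnalysis.sem_isAND_iff hH, DAnalysis.sem_andok_iff hH]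

/-- `ntakeAnd`. [folklore] -/
theorem sem_ntakeAnd_iff : P.sem x (Dc.ntakeAnd k) = true ↔
    ¬ (¬ (S.dead = true ∨ Stop (lab Dc) S) ∧ IsAND G S ∧ AndOK G (lab Dc) S) := by
  rw [P.sem_nor_singleton (Dc.kind_ntakeAnd k) (Dc.srcs_ntakeAnd k), wval_inr, Bool.not_eq_true', ← Bool.not_eq_true,
    sem_takeAnd_iff h hread hcol]

/-- **`takeOr`**: an individualisation step is taken (under the walk invariant). [folklore] -/
theorem sem_takeOr_iff (hW : WInv G n S) : P.sem x (Dc.takeOr k) = true ↔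
    ¬ (S.dead = true ∨ Stop (lab Dc) S) ∧ ¬ IsAND G S ∧ 2 ≤ S.A.card ∧ ∃ y, Dom (lab Dc) S y := by
  have hH := hypAn h hread hcol
  rw [P.sem_and (Dc.kind_takeOr k), Dc.srcs_takeOr]
  simp only [mem_insert, mem_singleton, forall_eq_or_imp, forall_eq, wval_inr, DAnalysis.sem_nfrozen_iff hH,
    DAnalysis.sem_isOR_iff hH]
  by_cases hA : IsAND G S
  · simp [hA]
  · rw [DAnalysis.sem_go_iff hH (DAnalysis.inv_of_winv hW hA)]
    tauto

/-- `ntakeOr`. [folklore] -/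
theorem sem_ntakeOr_iff (hW : WInv G n S) : P.sem x (Dc.ntakeOr k) = true ↔
    ¬ (¬ (S.dead = true ∨ Stop (lab Dc) S) ∧ ¬ IsAND G S ∧ 2 ≤ S.A.card ∧ ∃ y, Dom (lab Dc) S y) := by
  rw [P.sem_nor_singleton (Dc.kind_ntakeOr k) (Dc.srcs_ntakeOr k), wval_inr, Bool.not_eq_true', ← Bool.not_eq_true,
    sem_takeOr_iff h hread hcol hW]

/-- **`newMem w`**: `w` lies in the component of some point of `U`. [folklore] -/
theorem sem_newMem_iff (w : V) : P.sem x (Dc.newMem k w) = true ↔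
    ∃ u ∈ U, u ∈ S.A ∧ w ∈ BranchSum.swReach G S.A S.col u := by
  have hH := hypAn h hread hcol
  rw [P.sem_or (Dc.kind_newMem k w), Dc.srcs_newMem]
  simp only [mem_image, exists_exists_and_eq_and, wval_inr, DAnalysis.sem_reach_iff hH]

/-- The death gates. [folklore] -/
theorem sem_dx_iff (hW : WInv G n S) : P.sem x (Dc.dx k) = true ↔
    S.dead = true ∨
      (¬ (S.dead = true ∨ Stop (lab Dc) S) ∧
        ((IsAND G S ∧ ¬ AndOK G (lab Dc) S) ∨
          (¬ IsAND G S ∧ 2 ≤ S.A.card ∧ ¬ ∃ y, Dom (lab Dc) S y) ∨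
          (¬ IsAND G S ∧ ¬ 2 ≤ S.A.card))) := by
  have hH := hypAn h hread hcol
  rw [P.sem_or (Dc.kind_dx k), Dc.srcs_dx]
  simp only [mem_insert, mem_singleton, exists_eq_or_imp, exists_eq_left, hread.dead_iff, wval_inr]
  rw [P.sem_and (Dc.kind_d1 k), Dc.srcs_d1, P.sem_and (Dc.kind_d2 k), Dc.srcs_d2, P.sem_and (Dc.kind_d3 k), Dc.srcs_d3]
  simp only [mem_insert, mem_singleton, forall_eq_or_imp, forall_eq, wval_inr, DAnalysis.sem_nfrozen_iff hH,
    DAnalysis.sem_isAND_iff hH, DAnalysis.sem_nandok_iff hH, DAnalysis.sem_isOR_iff hH, DAnalysis.sem_nisAND_iff hH,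
    DAnalysis.sem_nbig2_iff hH]
  by_cases hA : IsAND G S
  · simp [hA]
  · rw [DAnalysis.sem_ngo_iff hH (DAnalysis.inv_of_winv hW hA)]
    constructor
    · rintro (hd | ⟨hf, hA', hno⟩ | ⟨hf, ⟨-, h2⟩, hng⟩ | ⟨hf, -, hsmall⟩)
      · exact Or.inl hd
      · exact absurd hA' hA
      · exact Or.inr ⟨hf, Or.inr (Or.inl ⟨hA, h2, fun he => hng ⟨h2, he⟩⟩)⟩
      · exact Or.inr ⟨hf, Or.inr (Or.inr ⟨hA, hsmall⟩)⟩
    · rintro (hd | ⟨hf, ⟨hA', -⟩ | ⟨-, h2, hno⟩ | ⟨-, hsmall⟩⟩)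
      · exact Or.inl hd
      · exact absurd hA' hA
      · exact Or.inr (Or.inr (Or.inl ⟨hf, ⟨hA, h2⟩, fun h' => hno h'.2⟩))
      · exact Or.inr (Or.inr (Or.inr ⟨hf, hA, hsmall⟩))

/-! ### One transition is one step of the walk -/

omit [Fintype V] h hread hcol in
/-- Under the walk invariant, the individualisation condition is "connected with at least two vertices". [folklore] -/
theorem isOR_iff_of_winv (hW : WInv G n S) : IsOR G S ↔ ¬ IsAND G S ∧ 2 ≤ S.A.card := by
  constructor
  · exact fun hO => ⟨hO.1, hO.2.1⟩
  · rintro ⟨hA, h2⟩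
    by_contra hO
    have := card_eq_one_of_leaf hW hA hO
    omega

/-- **The state wires of stage `k + 1` read `wstep G L S`.** [folklore] -/
theorem stateReads_succ (hW : WInv G n S) : Dc.StateReads x k.succ (wstep G (lab Dc) S) := by
  classical
  have hH := hypAn h hread hcol
  -- semantic values of the selectors
  have hTA := sem_takeAnd_iff h hread hcol
  have hNTA := sem_ntakeAnd_iff h hread hcol
  have hTO := sem_takeOr_iff h hread hcol hW
  have hNTO := sem_ntakeOr_iff h hread hcol hW
  -- the multiplexers, as propositions
  have hmx : ∀ v, wval x (P.sem x) (Dc.memS k.succ v) = true ↔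
      (v ∈ S.A ∧ ¬ (¬ (S.dead = true ∨ Stop (lab Dc) S) ∧ IsAND G S ∧ AndOK G (lab Dc) S)) ∨
        ((¬ (S.dead = true ∨ Stop (lab Dc) S) ∧ IsAND G S ∧ AndOK G (lab Dc) S) ∧
          ∃ u ∈ U, u ∈ S.A ∧ v ∈ BranchSum.swReach G S.A S.col u) := by
    intro v
    rw [Dc.memS_succ, wval_inr, P.sem_or (Dc.kind_mx k v), Dc.srcs_mx]
    simp only [mem_insert, mem_singleton, exists_eq_or_imp, exists_eq_left, wval_inr]
    rw [P.sem_and (Dc.kind_m1 k v), Dc.srcs_m1, P.sem_and (Dc.kind_m2 k v), Dc.srcs_m2]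
    simp only [mem_insert, mem_singleton, forall_eq_or_imp, forall_eq, wval_inr, hread.mem_iff, hNTA, hTA,
      sem_newMem_iff h hread hcol]
  have hvx : ∀ v (c : Fin D), wval x (P.sem x) (Dc.valS k.succ v c) = true ↔
      ((¬ (S.dead = true ∨ Stop (lab Dc) S) ∧ ¬ IsAND G S ∧ 2 ≤ S.A.card ∧ ∃ y, Dom (lab Dc) S y) ∧
          P.sem x ((Dc.RV k).val v c) = true) ∨
        (¬ (¬ (S.dead = true ∨ Stop (lab Dc) S) ∧ ¬ IsAND G S ∧ 2 ≤ S.A.card ∧ ∃ y, Dom (lab Dc) S y) ∧ S.col v = c) := by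
    intro v c
    rw [Dc.valS_succ, wval_inr, P.sem_or (Dc.kind_vx k v c), Dc.srcs_vx]
    simp only [mem_insert, mem_singleton, exists_eq_or_imp, exists_eq_left, wval_inr]
    rw [P.sem_and (Dc.kind_v1 k v c), Dc.srcs_v1, P.sem_and (Dc.kind_v2 k v c), Dc.srcs_v2]
    simp only [mem_insert, mem_singleton, forall_eq_or_imp, forall_eq, wval_inr, hread.val_iff, hNTO, hTO]
  have hcx : ∀ v, wval x (P.sem x) (Dc.consS k.succ v) = true ↔
      v ∈ S.C ∨ ((¬ (S.dead = true ∨ Stop (lab Dc) S) ∧ ¬ IsAND G S ∧ 2 ≤ S.A.card ∧ ∃ y, Dom (lab Dc) S y) ∧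
        P.sem x ((Dc.An k.castSucc).dom v) = true) := by
    intro v
    rw [Dc.consS_succ, wval_inr, P.sem_or (Dc.kind_cx k v), Dc.srcs_cx]
    simp only [mem_insert, mem_singleton, exists_eq_or_imp, exists_eq_left, wval_inr, hread.cons_iff]
    rw [P.sem_and (Dc.kind_c1 k v), Dc.srcs_c1]
    simp only [mem_insert, mem_singleton, forall_eq_or_imp, forall_eq, wval_inr, hTO]
  have hdx : wval x (P.sem x) (Dc.deadS k.succ) = P.sem x (Dc.dx k) := by rw [Dc.deadS_succ, wval_inr]
  have hDX := sem_dx_iff h hread hcol hW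
  -- case analysis of `wstep`
  by_cases hfr : S.dead = true ∨ Stop (lab Dc) S
  · -- frozen
    have hw : wstep G (lab Dc) S = S := by
      rcases hfr with hd | hs
      · exact wstep_of_dead hd
      · exact wstep_of_stop hs
    rw [hw]
    refine ⟨fun v => ?_, fun v c => ?_, fun v => ?_, ?_⟩
    · exact (hmx v).trans ⟨fun h' => h'.elim And.left fun h'' => absurd hfr h''.1.1, fun hv => Or.inl ⟨hv, fun h'' => h''.1 hfr⟩⟩
    · exact (hvx v c).trans ⟨fun h' => h'.elim (fun h'' => absurd hfr h''.1.1) And.right, fun hc => Or.inr ⟨fun h'' => h''.1 hfr, hc⟩⟩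
    · exact (hcx v).trans ⟨fun h' => h'.elim id fun h'' => absurd hfr h''.1.1, Or.inl⟩
    · rw [hdx, hDX]
      constructor
      · rintro (hd | ⟨hf, -⟩)
        · exact hd
        · exact absurd hfr hf
      · exact fun hd => Or.inl hd
  have hdead : S.dead = false := by
    cases hd : S.dead
    · rfl
    · exact absurd (Or.inl hd) hfr
  have hstop : ¬ Stop (lab Dc) S := fun hs => hfr (Or.inr hs)
  by_cases hA : IsAND G S
  · -- no individualisation step is taken at a section node
    have hvalA : ∀ v c, wval x (P.sem x) (Dc.valS k.succ v c) = true ↔ S.col v = c := fun v c =>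
      (hvx v c).trans ⟨fun h' => h'.elim (fun h'' => absurd hA h''.1.2.1) And.right, fun hc => Or.inr ⟨fun h'' => h''.2.1 hA, hc⟩⟩
    have hconsA : ∀ v, wval x (P.sem x) (Dc.consS k.succ v) = true ↔ v ∈ S.C := fun v =>
      (hcx v).trans ⟨fun h' => h'.elim id fun h'' => absurd hA h''.1.2.1, Or.inl⟩
    by_cases hok : AndOK G (lab Dc) S
    · -- section step
      have hw : wstep G (lab Dc) S = ⟨andBlock G (lab Dc) S, S.col, S.C, false⟩ := by
        unfold wstep; rw [if_neg (by simp [hdead]), if_neg hstop, if_pos hA, if_pos hok]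
      rw [hw]
      obtain ⟨u₀, hu₀⟩ := hok.1
      obtain ⟨hu₀A, hblock⟩ := andBlock_eq hok hu₀
      refine ⟨fun v => ?_, hvalA, hconsA, ?_⟩
      · rw [hmx]
        change _ ↔ v ∈ andBlock G (lab Dc) S
        rw [hblock]
        constructor
        · rintro (⟨-, hno⟩ | ⟨-, u, hu, huA, hv⟩)
          · exact absurd ⟨hfr, hA, hok⟩ hno
          · rw [BranchSum.swReach_eq_of_mem _ huA (hok.2 u hu u₀ hu₀)]; exact hv
        · intro hv
          exact Or.inr ⟨⟨hfr, hA, hok⟩, u₀, hu₀, hu₀A, hv⟩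
      · rw [hdx, hDX]
        change _ ↔ false = true
        simp only [Bool.false_eq_true, iff_false, not_or, hdead, not_and, not_not]
        refine ⟨fun hf => hf, fun _ => ⟨fun _ => hok, fun hA' => absurd hA hA', fun hA' => absurd hA hA'⟩⟩
    · -- section node, `U` not in one component: death
      have hw : wstep G (lab Dc) S = { S with dead := true } := by
        unfold wstep; rw [if_neg (by simp [hdead]), if_neg hstop, if_pos hA, if_neg hok]
      rw [hw]
      refine ⟨fun v => ?_, hvalA, hconsA, ?_⟩
      · exact (hmx v).trans ⟨fun h' => h'.elim And.left fun h'' => absurd h''.1.2.2 hok, fun hv => Or.inl ⟨hv, fun h'' => hok h''.2.2⟩⟩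
      · rw [hdx, hDX]; change _ ↔ true = true; simp only [iff_true]; exact Or.inr ⟨hfr, Or.inl ⟨hA, hok⟩⟩
  · have hinv := DAnalysis.inv_of_winv hW hA
    have hmemO : ∀ v, wval x (P.sem x) (Dc.memS k.succ v) = true ↔ v ∈ S.A := fun v =>
      (hmx v).trans ⟨fun h' => h'.elim And.left fun h'' => absurd h''.1.2.1 hA, fun hv => Or.inl ⟨hv, fun h'' => hA h''.2.1⟩⟩
    by_cases h2 : 2 ≤ S.A.card
    · have hO : IsOR G S := (isOR_iff_of_winv hW).2 ⟨hA, h2⟩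
      by_cases hdom : ∃ y, Dom (lab Dc) S y
      · -- individualisation step
        have hw : wstep G (lab Dc) S =
            ⟨S.A, BranchSum.refineIn G S.A (BranchSum.indiv S.col hdom.choose), insert hdom.choose S.C, false⟩ := by
          unfold wstep; rw [if_neg (by simp [hdead]), if_neg hstop, if_neg hA, if_pos hO, dif_pos hdom]
        rw [hw]
        have hy := hdom.choose_spec
        have hTOt : ¬ (S.dead = true ∨ Stop (lab Dc) S) ∧ ¬ IsAND G S ∧ 2 ≤ S.A.card ∧ ∃ y, Dom (lab Dc) S y :=
          ⟨hfr, hA, h2, hdom⟩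
        refine ⟨hmemO, fun v c => ?_, fun v => ?_, ?_⟩
        · rw [hvx, sem_RVval_iff h hread hcol hinv h2 hy]
          exact ⟨fun h' => h'.elim And.right fun h'' => absurd hTOt h''.1, fun hc => Or.inl ⟨hTOt, hc⟩⟩
        · rw [hcx, DAnalysis.sem_dom_iff_eq hH hinv h2 hy]
          change _ ↔ v ∈ insert hdom.choose S.C
          rw [mem_insert]
          exact ⟨fun h' => h'.elim Or.inr fun h'' => Or.inl h''.2, fun h' => h'.elim (fun hv => Or.inr ⟨hTOt, hv⟩) Or.inl⟩
        · rw [hdx, hDX]; change _ ↔ false = true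
          simp only [Bool.false_eq_true, iff_false, not_or, hdead, not_and]
          exact ⟨fun hf => hf, fun _ => ⟨fun hA' => absurd hA' hA, fun _ _ hno => hno hdom, fun _ hs => hs h2⟩⟩
      · -- individualisation node without a dominating candidate: death
        have hw : wstep G (lab Dc) S = { S with dead := true } := by
          unfold wstep; rw [if_neg (by simp [hdead]), if_neg hstop, if_neg hA, if_pos hO, dif_neg hdom]
        rw [hw]
        refine ⟨hmemO, fun v c => ?_, fun v => ?_, ?_⟩
        · exact (hvx v c).trans ⟨fun h' => h'.elim (fun h'' => absurd h''.1.2.2.2 hdom) And.right,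
            fun hc => Or.inr ⟨fun h'' => hdom h''.2.2.2, hc⟩⟩
        · exact (hcx v).trans ⟨fun h' => h'.elim id fun h'' => absurd h''.1.2.2.2 hdom, Or.inl⟩
        · rw [hdx, hDX]; change _ ↔ true = true; simp only [iff_true]
          exact Or.inr ⟨hfr, Or.inr (Or.inl ⟨hA, h2, hdom⟩)⟩
    · -- a leaf (a singleton under the invariant): death
      have hO : ¬ IsOR G S := fun hO => h2 hO.2.1
      have hw : wstep G (lab Dc) S = { S with dead := true } := by
        unfold wstep; rw [if_neg (by simp [hdead]), if_neg hstop, if_neg hA, if_neg hO]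
      rw [hw]
      refine ⟨hmemO, fun v c => ?_, fun v => ?_, ?_⟩
      · exact (hvx v c).trans ⟨fun h' => h'.elim (fun h'' => absurd h''.1.2.2.1 h2) And.right,
          fun hc => Or.inr ⟨fun h'' => h2 h''.2.2.1, hc⟩⟩
      · exact (hcx v).trans ⟨fun h' => h'.elim id fun h'' => absurd h''.1.2.2.1 h2, Or.inl⟩
      · rw [hdx, hDX]; change _ ↔ true = true; simp only [iff_true]
        exact Or.inr ⟨hfr, Or.inr (Or.inr ⟨hA, h2⟩)⟩

end Stage

/-! ### The module performs the walk -/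

/-- Colours stay below `D` along a step (`|V| ≤ D`). [folklore] -/
theorem col_lt_wstep (hD : Fintype.card V ≤ D) (L : CertifiedLabels.Label V) {S : WState V} (hcol : ∀ v, S.col v < D) (v : V) :
    (wstep G L S).col v < D := by
  unfold wstep
  split_ifs
  · exact hcol v
  · exact hcol v
  · exact hcol v
  · exact hcol v
  · by_cases hv : v ∈ S.A
    · exact (refineIn_lt_card _ hv).trans_le ((card_le_univ _).trans hD)
    · show BranchSum.refineIn G S.A _ v < D
      rw [refineIn_of_not_mem _ hv]
      exact lt_of_lt_of_le (card_pos.2 ⟨v, mem_univ v⟩) hD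
  · exact hcol v
  · exact hcol v

/-- Colours stay below `D` along the walk. [folklore] -/
theorem col_lt_walk (hD : Fintype.card V ≤ D) (L : CertifiedLabels.Label V) {S : WState V} (hcol : ∀ v, S.col v < D) (k : ℕ)
    (v : V) : (walk G L S k).col v < D := by
  induction k generalizing v with
  | zero => exact hcol v
  | succ k ih =>
    unfold walk; rw [Function.iterate_succ_apply']
    exact col_lt_wstep hD L ih v

/-- **The decode module performs the walk of its label**: if stage `0` reads a state satisfying the walk invariant with
colours `< D`, then stage `k` reads the `k`-th walk state, for every `k ≤ F`. [folklore] -/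
theorem stateReads_walk (h : Dc.Hyp x G) (hn : Fintype.card V ≤ n) {S₀ : WState V}
    (h₀ : Dc.StateReads x 0 S₀) (hW : WInv G n S₀) (hcol : ∀ v, S₀.col v < D) :
    ∀ (k : ℕ) (hk : k < F + 1), Dc.StateReads x ⟨k, hk⟩ (walk G (lab Dc) S₀ k) := by
  intro k
  induction k with
  | zero => intro hk; exact h₀
  | succ k ih =>
    intro hk
    have hkF : k < F := Nat.lt_of_succ_lt_succ hk
    have hprev := ih (Nat.lt_of_lt_of_le hkF (Nat.le_succ F))
    have hsucc : (⟨k + 1, hk⟩ : Fin (F + 1)) = (⟨k, hkF⟩ : Fin F).succ := rfl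
    rw [hsucc, walk_succ']
    exact stateReads_succ h (k := ⟨k, hkF⟩) hprev (col_lt_walk h.hD _ hcol k) (winv_walk hn hW k)
where
  /-- one more step, at the tail -/
  walk_succ' {L : CertifiedLabels.Label V} {S : WState V} {k : ℕ} : walk G L S (k + 1) = wstep G L (walk G L S k) := by
    unfold walk; rw [Function.iterate_succ_apply']

end Decode

end Summit.PneNP.PneNP.Theorems
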